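import Summits.BirchSwinnertonDyer.Rank1Residual.X11b.SelmerTorsionControl
import HarnessLib

/-!
# Route `ErratumRoadFive` (K2, `p ≥ 5`), crux (T) `Rest3TorsionBranchAtFive` (item
# stmt-BirchSwinnertonDyer-19702): erratum Lemma 2.1 WITHOUT the local vanishing — `Sel(M[r]) → Sel(M)[r]`
# is injective with a DEFECT controlled by the local invariants `M^{Γ_v}` (THEOREM T♭, memo §31.2, R31-2)

Cell `bsd-stepL` (run/shared/lean/pub/bsd-stepL/), seat `bsd-stepL-bdp` (prover g14, 2026-08-26), memo
`HOME/proof/PROOF-BDP.md` §31.2 (first paragraph) / §32; `--supports stmt-BirchSwinnertonDyer-19702 --as helper`.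
Written in multr1-p1's kernel currency for the erratum's Lemma 2.1 (`X11b/SelmerTorsionControl.lean`,
`X11b/TorsionCohomologyControl.lean`: discrete `A`-linear `Γ`-modules `ContinuousRep Γ A M`, continuous
`H¹`, `selmer φ L ρ ⊆ H¹(Γ, M)` cut out by vanishing of the restrictions along `φ_v : Γ_v → Γ`, `v ∈ L`;
the torsion sequence `0 → M[r] → M →ʳ M → 0` and its connecting map `δ₀`).

HONEST FRAMING: theorems only (no definition, no named fact, no `sorry`), PURE (continuous-cohomological)
ALGEBRA on abstract data; the arithmetic objects (`G_{K,S}`, `M_E = T ⊗ Λ^*`, `M_{g_m}`) are not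
constructed in the tree — exactly the status of multr1-p1's exact-case files. Nothing about the erratum's
inputs or any preprint is asserted; nothing is booked; no census word, tier or label moves (T7).

## What and why

Castella's erratum, Lemma 2.1 (p. 2, verbatim): «`Sel^Σ_𝔭(K, M_g)[ϖ^m]` is the kernel of the composite
map `H¹(G_{K,S}, M_g[ϖ^m]) → H¹(K_𝔭, M_g[ϖ^m]) → H¹(K_𝔭, M_g)[ϖ^m]`. Since the kernel of the second arrow
is given by `H⁰(K_𝔭, M_g)/ϖ^m H⁰(K_𝔭, M_g)` and this vanishes when so does `H⁰(K_𝔭, A_g[ϖ])`, the proof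
concludes» — the ONLY use of hypothesis (iv) `E(ℚ_p)[p] = 0`. multr1-p1 kernel-checked it as
`TorsionControl.map_torsionInclH1_selmer` ∕ `selmerTorsionEquiv` with the local hypothesis `hloc`
(«`M^{Γ_v}` is `r`-divisible»). THEOREM T♭ (memo §31) reads the same sentence WITHOUT the vanishing: the
map is still injective (global invariants only) and its cokernel — the CONTROL DEFECT — is governed by
the local invariants `M^{Γ_v}`. THIS FILE kernel-checks that reading (referee ask R31-2), with NO local
hypothesis:

* `map_selmer_torsion_le` — `H¹(ι)(Sel(M[r])) ⊆ Sel(M) ∩ H¹(Γ, M)[r]` (always).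
* `exists_lift_with_local_defect` — for `r`-divisible `M`, every `y ∈ Sel(M)[r]` lifts to
  `x ∈ H¹(Γ, M[r])` with `H¹(ι)x = y`, and for each constrained `v` the local class `res_v x` is
  `δ₀^{(v)}(w_v)` for some local invariant `w_v ∈ M^{Γ_v}` (exactness of
  `M^{Γ_v} →δ₀ H¹(Γ_v, M[r]) → H¹(Γ_v, M)` at the restriction of `x`, which dies in `H¹(Γ_v, M)` because
  `y` is Selmer): the defect witnesses.
* `res_lift_eq_zero_iff_divisible` — `res_v x = 0 ↔ w_v ∈ r·M^{Γ_v}`: the defect of `y` at `v` is the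
  class of `w_v` in `M^{Γ_v}/r M^{Γ_v}` («the kernel of the second arrow is `H⁰(K_𝔭, M)/ϖ^m`»).
* `mem_map_selmer_iff_forall_res_eq_zero` — for `r`-divisible GLOBAL invariants `M^Γ` (e.g. `= 0`,
  erratum (irred_K)), `y ∈ H¹(ι)(Sel(M[r])) ↔ ∀ v ∈ L, res_v x = 0` (the lift is unique): so the defect
  `Sel(M)[r] / H¹(ι)Sel(M[r])` EMBEDS into `⊕_{v ∈ L} M^{Γ_v}/r M^{Γ_v}` (memo §31.2: «the DEFECT is the
  finite module `D_m := coker ↪ H⁰(K_𝔭, M)/ϖ^m`»).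
* `smul_mem_map_selmer_of_forall_smul_invariants_eq_zero` — **the exponent bound, NO global hypothesis**:
  if `a ∈ A` kills every local invariant `M^{Γ_v}` (`v ∈ L`), then `a · (Sel(M) ∩ H¹(Γ,M)[r]) ⊆
  H¹(ι)(Sel(M[r]))` — the control defect is killed by `a`, UNIFORMLY IN `r`. With (L1)
  (`ErratumRoadFiveTateTorsionRigidity*.lean`: `H⁰(K_𝔭, M_E) = ⊕_w E(K_{∞,w})[p^∞] ⊗ 𝒪` is killed by
  `a = p^k` for EVERY layer) this is the binder «`Kd_m` killed by `π^k` uniformly in `m`» of g13's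
  `BoundedCongruenceLimit.charIdeal_le_span_of_congruences_boundedKernel` (after Pontryagin duality).

Dictionary: `Γ = G_{K,S}` (`S = Σ ∪ S_p`), `Γ_v = G_{K_𝔭}` (the strict place), `L = {𝔭}` (or `{𝔭}` ∪ the
relaxed-zero places), `M = M_E = T_pE ⊗ Λ^*` or `M_{g_m}`, `A = Λ_𝒪`, `r = ϖ^m`; `M^{Γ_𝔭} = H⁰(K_𝔭, M)`,
by Shapiro `⊕_{w ∣ 𝔭} E(K_{∞,w})[p^∞] ⊗ 𝒪` (memo §31.2 (E)); `a = p^k`.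

References: [Castella2018Erratum] Lemma 2.1 and Remark (2) (p. 2); [SerreGaloisCohomology1997] I §2.2–2.4;
memo PROOF-BDP §31.2; `X11b/SelmerTorsionControl.lean`, `X11b/TorsionCohomologyControl.lean` (multr1-p1).
-/

set_option autoImplicit false
-- the Theorems namespace of this sub repeats the summit name by design (D-0017 nested layout)
set_option linter.dupNamespace false

noncomputable section

open CategoryTheory Literature.NumberTheory.GaloisRepresentations
  Summit.BirchSwinnertonDyer.Rank1Residual.X11b.TorsionControl
open scoped ContRepresentation

universe u

namespace Summit.BirchSwinnertonDyer.BirchSwinnertonDyer.Theorems.SelmerControlDefect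

variable {A : Type*} [CommRing A] [TopologicalSpace A]
variable {Γ : Type u} [Group Γ] [TopologicalSpace Γ] [IsTopologicalGroup Γ]
variable {M : Type u} [AddCommGroup M] [Module A M] [TopologicalSpace M] [DiscreteTopology M]
  [ContinuousSMul A M]
variable {ι : Type*} {Γv : ι → Type u} [∀ v, Group (Γv v)] [∀ v, TopologicalSpace (Γv v)]
  [∀ v, IsTopologicalGroup (Γv v)] (φ : ∀ v, Γv v →ₜ* Γ) (L : Set ι)
variable (ρ : ContinuousRep Γ A M) (r : A)

/-- **`H¹(ι)(Sel(M[r])) ⊆ Sel(M) ∩ H¹(Γ, M)[r]`** — the inclusion that holds with no hypothesis at all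
(naturality of restriction, and `H¹(ι)` lands in the `r`-torsion). [cite: Castella2018Erratum, Lemma 2.1] -/
theorem map_selmer_torsion_le :
    Submodule.map (torsionInclH1 ρ r) (selmer φ L (torsionRep ρ r)) ≤
      selmer φ L ρ ⊓ Submodule.torsionBy A (continuousCohomology 1 ρ.toTopRep) r := by
  rintro _ ⟨x, hx, rfl⟩
  exact ⟨cohomologyMap_mem_selmer φ L (torsionIncl ρ r) hx,
    (Submodule.mem_torsionBy_iff r _).mpr (smul_cohomologyMap_torsionIncl ρ r x)⟩

/-- **Lift with local defect witnesses (erratum Lemma 2.1 read WITHOUT the vanishing).** `M` a discrete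
`A`-linear `Γ`-module on which `r` acts surjectively. Every Selmer class `y ∈ Sel(M)` killed by `r` lifts
to `x ∈ H¹(Γ, M[r])` with `H¹(ι) x = y`, and for every constrained `v ∈ L` the restriction `res_v x ∈
H¹(Γ_v, M[r])` — which dies in `H¹(Γ_v, M)` because `y` is Selmer — is the connecting image
`δ₀^{(v)}(w_v)` of a LOCAL INVARIANT `w_v ∈ M^{Γ_v}` («the kernel of the second arrow is given by
`H⁰(K_𝔭, M_g)/ϖ^m H⁰(K_𝔭, M_g)`»). No local and no global vanishing hypothesis.
[cite: Castella2018Erratum, Lemma 2.1] [cite: SerreGaloisCohomology1997, I §2.2] -/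
theorem exists_lift_with_local_defect (hr : Function.Surjective fun m : M => r • m)
    {y : continuousCohomology 1 ρ.toTopRep} (hy : y ∈ selmer φ L ρ) (hry : r • y = 0) :
    ∃ x : continuousCohomology 1 (torsionRep ρ r).toTopRep, torsionInclH1 ρ r x = y ∧
      ∀ v ∈ L, ∃ w : ((ρ.restrict (φ v)).toTopRep).ρ.invariants,
        (isSES_torsion (ρ.restrict (φ v)) r hr).δ₀ w = resH1 (torsionRep ρ r) (φ v) x := by
  obtain ⟨x, hx⟩ := exists_cohomologyMap_torsionIncl_eq ρ r hr y hry
  refine ⟨x, hx, fun v hv => ?_⟩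
  -- `res_v x` dies in `H¹(Γ_v, M)`: it maps to `res_v y = 0`
  have h1 := resH1_cohomologyMap (φ v) (torsionIncl ρ r) x
  rw [hx, (mem_selmer_iff φ L ρ y).mp hy v hv] at h1
  -- `restrictHom (φ v) (torsionIncl ρ r) = torsionIncl (ρ.restrict (φ v)) r` definitionally
  have h0 : cohomologyMap (torsionIncl (ρ.restrict (φ v)) r) 1 (resH1 (torsionRep ρ r) (φ v) x) = 0 :=
    h1.symm
  exact (cohomologyMap_torsionIncl_eq_zero_iff (ρ.restrict (φ v)) r hr _).mp h0

/-- **The defect at `v` is the class of `w_v` in `M^{Γ_v}/r M^{Γ_v}`**: for a local invariant `w` with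
`δ₀^{(v)} w = res_v x`, the local class `res_v x` vanishes iff `w` is `r`-divisible inside `M^{Γ_v}`
(exactness at `M^{Γ_v}` of `M^{Γ_v} →ʳ M^{Γ_v} →δ₀ H¹(Γ_v, M[r])`). In particular under the erratum's (iv)
(`M^{Γ_v}` `r`-divisible) every defect vanishes — multr1-p1's exact case. [cite: SerreGaloisCohomology1997, I §2.2] -/
theorem res_lift_eq_zero_iff_divisible (hr : Function.Surjective fun m : M => r • m) (v : ι)
    (x : continuousCohomology 1 (torsionRep ρ r).toTopRep)
    (w : ((ρ.restrict (φ v)).toTopRep).ρ.invariants)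
    (hw : (isSES_torsion (ρ.restrict (φ v)) r hr).δ₀ w = resH1 (torsionRep ρ r) (φ v) x) :
    resH1 (torsionRep ρ r) (φ v) x = 0 ↔
      ∃ w' ∈ ((ρ.restrict (φ v)).toTopRep).ρ.invariants, r • w' = (w : M) := by
  have key := (isSES_torsion (ρ.restrict (φ v)) r hr).δ₀_eq_zero_iff w
  constructor
  · intro h
    obtain ⟨w', hw', hrw⟩ := key.mp (hw.trans h)
    exact ⟨w', hw', hrw⟩
  · rintro ⟨w', hw', hrw⟩
    exact hw.symm.trans (key.mpr ⟨w', hw', hrw⟩)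

/-- **Image criterion (the lift is unique when `M^Γ` is `r`-divisible).** If the GLOBAL invariants `M^Γ`
are `r`-divisible (e.g. `M^Γ = 0`: «`H⁰(K, M_g) = 0`» from irreducibility — erratum (irred_K), kept by T♭),
then for `y ∈ Sel(M)` and ANY lift `x` (`H¹(ι) x = y`): `y ∈ H¹(ι)(Sel(M[r])) ↔ res_v x = 0` for every
constrained `v`. Hence the control defect `Sel(M)[r]/H¹(ι)Sel(M[r])` injects, via `y ↦ (w_v)_v`, into
`⊕_{v ∈ L} M^{Γ_v}/r M^{Γ_v}` (with `res_lift_eq_zero_iff_divisible`): memo §31.2 «`D_m := coker ↪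
H⁰(K_𝔭, M)/ϖ^m H⁰(K_𝔭, M)`». [cite: Castella2018Erratum, Lemma 2.1] -/
theorem mem_map_selmer_iff_forall_res_eq_zero (hr : Function.Surjective fun m : M => r • m)
    (hglob : ∀ w ∈ ρ.toTopRep.ρ.invariants, ∃ w' ∈ ρ.toTopRep.ρ.invariants, r • w' = w)
    {y : continuousCohomology 1 ρ.toTopRep} (x : continuousCohomology 1 (torsionRep ρ r).toTopRep)
    (hx : torsionInclH1 ρ r x = y) :
    y ∈ Submodule.map (torsionInclH1 ρ r) (selmer φ L (torsionRep ρ r)) ↔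
      ∀ v ∈ L, resH1 (torsionRep ρ r) (φ v) x = 0 := by
  constructor
  · rintro ⟨x', hx', hxy⟩
    have hxx : x' = x :=
      cohomologyMap_torsionIncl_injective ρ r hr hglob (hxy.trans hx.symm)
    subst hxx
    exact (mem_selmer_iff φ L (torsionRep ρ r) x').mp hx'
  · intro h
    exact ⟨x, (mem_selmer_iff φ L (torsionRep ρ r) x).mpr h, hx⟩

/-- **THE EXPONENT BOUND OF THE CONTROL DEFECT (memo §31.2 (F)), no global and no local vanishing
hypothesis.** `M` a discrete `A`-linear `Γ`-module on which `r` acts surjectively; suppose `a ∈ A` kills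
every LOCAL invariant at the constrained places: `a · M^{Γ_v} = 0` for all `v ∈ L`. Then
`a · (Sel(M) ∩ H¹(Γ, M)[r]) ⊆ H¹(ι)(Sel(M[r]))` — the cokernel of `Sel(M[r]) → Sel(M)[r]` is killed by `a`,
and `a` does not depend on `r`. Proof: lift `y` to `x` with defect witnesses `w_v` (`res_v x = δ₀ w_v`);
then `res_v (a·x) = δ₀(a·w_v) = δ₀ 0 = 0`, so `a·x ∈ Sel(M[r])` and `H¹(ι)(a·x) = a·y`. For T♭: `r = ϖ^m`,
`a = p^k` kills `H⁰(K_𝔭, M_E) = ⊕_w E(K_{∞,w})[p^∞] ⊗ 𝒪` for EVERY `m` by (L1) — the uniform exponent of the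
kernels `Kd_m` in `BoundedCongruenceLimit.charIdeal_le_span_of_congruences_boundedKernel`.
[cite: Castella2018Erratum, Lemma 2.1 and Remark (2) (p. 2)] -/
theorem smul_mem_map_selmer_of_forall_smul_invariants_eq_zero
    (hr : Function.Surjective fun m : M => r • m) (a : A)
    (ha : ∀ v ∈ L, ∀ w : M, w ∈ ((ρ.restrict (φ v)).toTopRep).ρ.invariants → a • w = 0)
    {y : continuousCohomology 1 ρ.toTopRep} (hy : y ∈ selmer φ L ρ) (hry : r • y = 0) :
    a • y ∈ Submodule.map (torsionInclH1 ρ r) (selmer φ L (torsionRep ρ r)) := by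
  obtain ⟨x, hx, hloc⟩ := exists_lift_with_local_defect φ L ρ r hr hy hry
  refine ⟨a • x, (mem_selmer_iff φ L (torsionRep ρ r) _).mpr fun v hv => ?_, by rw [map_smul, hx]⟩
  obtain ⟨w, hw⟩ := hloc v hv
  have haw : a • w = 0 := Subtype.ext (by simpa using ha v hv w.1 w.2)
  have h1 : resH1 (torsionRep ρ r) (φ v) (a • x) = a • resH1 (torsionRep ρ r) (φ v) x := map_smul _ _ _
  have h2 : a • (isSES_torsion (ρ.restrict (φ v)) r hr).δ₀ w = 0 := by rw [← map_smul, haw, map_zero]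
  have h3 : a • resH1 (torsionRep ρ r) (φ v) x = a • (isSES_torsion (ρ.restrict (φ v)) r hr).δ₀ w :=
    congrArg (fun z => a • z) hw.symm
  exact h1.trans (h3.trans h2)

/-- Submodule form of the exponent bound: `a • (Sel(M) ⊓ H¹(Γ,M)[r]) ≤ H¹(ι)(Sel(M[r]))`, stated
elementwise on the intersection. [cite: Castella2018Erratum, Lemma 2.1 and Remark (2) (p. 2)] -/
theorem smul_mem_map_selmer_of_mem_inf (hr : Function.Surjective fun m : M => r • m) (a : A)
    (ha : ∀ v ∈ L, ∀ w : M, w ∈ ((ρ.restrict (φ v)).toTopRep).ρ.invariants → a • w = 0)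
    {y : continuousCohomology 1 ρ.toTopRep}
    (hy : y ∈ selmer φ L ρ ⊓ Submodule.torsionBy A (continuousCohomology 1 ρ.toTopRep) r) :
    a • y ∈ Submodule.map (torsionInclH1 ρ r) (selmer φ L (torsionRep ρ r)) :=
  smul_mem_map_selmer_of_forall_smul_invariants_eq_zero φ L ρ r hr a ha hy.1
    ((Submodule.mem_torsionBy_iff r y).mp hy.2)

omit [TopologicalSpace A] [TopologicalSpace M] [DiscreteTopology M] [ContinuousSMul A M] in
/-- If `b` acts surjectively on `M` then so does every power `b ^ m` (induction). [folklore] -/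
theorem pow_smul_surjective (b : A) (hb : Function.Surjective fun m : M => b • m) (m : ℕ) :
    Function.Surjective fun x : M => b ^ m • x := by
  induction m with
  | zero => intro x; exact ⟨x, by simp⟩
  | succ m ih =>
    intro x
    obtain ⟨x₁, hx₁⟩ := hb x
    obtain ⟨x₂, hx₂⟩ := ih x₁
    refine ⟨x₂, ?_⟩
    simp only at hx₁ hx₂ ⊢
    rw [pow_succ', mul_smul, hx₂, hx₁]

/-- **Powers: the defect at level `r = b ^ m` is killed by `a` for EVERY `m`** — the uniformity in the
level that THEOREM T♭ needs (`b = ϖ`, `a = p^k`): if `b` acts surjectively on `M` and `a` kills the local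
invariants, then for all `m ≥ 1`… (indeed all `m`), `a · (Sel(M) ∩ H¹(Γ,M)[b^m]) ⊆ H¹(ι_m)(Sel(M[b^m]))`.
[cite: Castella2018Erratum, Lemma 2.1 and Remark (2) (p. 2)] -/
theorem smul_mem_map_selmer_pow (b : A) (hb : Function.Surjective fun m : M => b • m) (a : A)
    (ha : ∀ v ∈ L, ∀ w : M, w ∈ ((ρ.restrict (φ v)).toTopRep).ρ.invariants → a • w = 0)
    (m : ℕ) {y : continuousCohomology 1 ρ.toTopRep} (hy : y ∈ selmer φ L ρ) (hry : b ^ m • y = 0) :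
    a • y ∈ Submodule.map (torsionInclH1 ρ (b ^ m)) (selmer φ L (torsionRep ρ (b ^ m))) :=
  smul_mem_map_selmer_of_forall_smul_invariants_eq_zero φ L ρ (b ^ m) (pow_smul_surjective b hb m) a ha
    hy hry

end Summit.BirchSwinnertonDyer.BirchSwinnertonDyer.Theorems.SelmerControlDefect

end
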